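import Summits.CriticalPhenomena.CardyFormulaZ2.Theorems.CardyIKTransportIKLinearTransportCouplingLift2

/-!
# `stub_LinearTransport` (crux stmt-CriticalPhenomena-5076, line `pinned-diagram-exchange`) — RESHAPE,
# part 4 of 4: the sorry-free compositions

Theorem-only support file (`--supports stmt-CriticalPhenomena-5076`, registered sub-goals
`linearTransport_of_parts`, `linearTransport_of_parts_far`, `condRSW_of_farRSW`) of the reshape
`stub_LinearTransport = stripLaw (S₁) → windowTransport (S₂, open) → couplingLift (S₃)` (see the header of
`…TransportDefs`; S₁ is proved there, S₃ in `…CouplingLift2`).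

* `isTransportCoupling_of_window` — the common tail: from `K₁` with the window-transport property (the
  conclusion of S₂), the strip law (S₁) and the lift (S₃), `IsTransportCoupling K₁`: given `ε ρ`, take the
  block scale `A` of S₃, intersect S₂'s eventual mesh set with `δ ∈ (0,1)`, turn the block conditions
  `|j| ≤ ⌈A/δ⌉ → j ∈ S₀ ∧ j ∉ S₁` into the two window-law hypotheses by the strip law (`determinedOn` is
  monotone and `ballInf 0 R ⊆ colStrip (−R) R`), lift, and chain `γ(badPair) ≤ π(badObs) ≤ ε`.
* `linearTransport_of_parts` — S₁ → S₂ → S₃ → the REGISTERED signature of `stub_LinearTransport` verbatim,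
  where S₂ = `windowTransport` is stated with the registered a-priori hypothesis family `CondRSWBound`
  (aspect `2`, conditioning fraction `1`).
* `linearTransport_of_parts_far` — S₁ → S₂-far → S₃ → (kernels → far RSW family `FarRSWBound` at every aspect
  bound `k` → ratio mixing family `RatioMixBound` → `∃ K₁, IsTransportCoupling K₁`), the variant whose middle
  piece carries the a-priori inputs Manolescu's printed proof consumes (arXiv:2502.08394 Thm 5.7 for all
  aspect ratios with rings, Prop. 5.9), made explicit because without FKG they are not known to follow from
  the registered family.
* `condRSW_of_farRSW` — the far RSW family implies the registered conditional RSW family (instances `k = 2`,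
  `(w, h) = (2n, n)` and `(n, 2n)`).

The S₂ statements enter as HYPOTHESES only; nothing here uses `sorry`.
-/

noncomputable section

namespace Summit.CriticalPhenomena.CardyFormulaZ2.Theorems.IKLinearTransport.PinnedDiagramExchange

open scoped BigOperators Topology Classical MeasureTheory ProbabilityTheory ENNReal
open Filter Set Function MeasureTheory
open Literature.Probability.Percolation Literature.Probability.LatticeModels
open Literature.Probability.RandomPlanarGeometry

/-! ## Sorry-free glue -/

/-- `determinedOn` is monotone in the set of cells/faces (local copy of the r4-line lemma). [folklore] -/
theorem ltr_determinedOn_mono {Λ Λ' : Set (Site 2)} (h : Λ ⊆ Λ') {E : Set Obs}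
    (hE : E ∈ determinedOn Λ) : E ∈ determinedOn Λ' :=
  fun x y hxy => hE x y fun v hv => hxy v (h hv)

/-- The sup-ball of radius `R` around the origin lies in the column strip `[-R, R]`. [folklore] -/
theorem ballInf_zero_subset_colStrip (R : ℕ) : ballInf 0 R ⊆ colStrip (-(R : ℤ)) R := by
  intro v hv
  have h0 : |v 0| ≤ (R : ℤ) := by simpa only [Pi.zero_apply, sub_zero] using hv.1
  exact ⟨(abs_le.1 h0).1, (abs_le.1 h0).2⟩

/-- THE FAR RSW FAMILY IMPLIES THE REGISTERED CONDITIONAL RSW FAMILY (instances `k = 2`,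
`(w, h) = (2n, n)` and `(n, 2n)`). [folklore] -/
theorem condRSW_of_farRSW :
    (∀ k : ℕ, ∃ c : ℝ, 0 < c ∧ ∀ (S : Set ℤ) (n : ℕ), 1 ≤ n → ∀ (a b : ℤ) (w h : ℕ),
        n ≤ w → w ≤ k * n → n ≤ h → h ≤ k * n → ∀ E : Set Obs, MeasurableSet E →
        FarRSWBound c S n a b w h E) →
    ∃ c : ℝ, 0 < c ∧ ∀ (S : Set ℤ) (n : ℕ), 1 ≤ n → ∀ (a b : ℤ) (E : Set Obs), MeasurableSet E →
      CondRSWBound c S n a b E := by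
  intro h
  obtain ⟨c, hc, hfar⟩ := h 2
  refine ⟨c, hc, fun S n hn a b E hE => ⟨fun hdet => ?_, fun hdet => ?_⟩⟩
  · exact (hfar S n hn a b (2 * n) n (by omega) le_rfl le_rfl (by omega) E hE hdet).1
  · exact (hfar S n hn a b n (2 * n) le_rfl (by omega) (by omega) le_rfl E hE hdet).2.1

/-- The common tail of the two compositions: from `K₁` with the window-transport property, the strip
law and the lift, the transport coupling `IsTransportCoupling K₁`. [folklore] -/
theorem isTransportCoupling_of_window
    (hS₁ : ∀ (S S' : Set ℤ) (a b : ℤ), (∀ j : ℤ, a ≤ j → j ≤ b → (j ∈ S ↔ j ∈ S')) →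
      ∀ E : Set Obs, MeasurableSet E → E ∈ determinedOn (colStrip a b) → νmix S E = νmix S' E)
    (hS₃ : ∀ (K : ℂ ≃L[ℝ] ℂ) (ε ρ : ℝ), ∃ A : ℝ, 0 < A ∧ ∀ δ : ℝ, 0 < δ → δ ≤ 1 →
      ∀ (S₀ S₁ : Set ℤ) (π : Measure (Obs × Obs)),
        π.map Prod.fst = νmix S₀ → π.map Prod.snd = νmix S₁ →
        (∀ E : Set Obs, MeasurableSet E → E ∈ determinedOn (ballInf 0 ⌈A / δ⌉₊) →
          νmix S₀ E = νmix Set.univ E) →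
        (∀ E : Set Obs, MeasurableSet E → E ∈ determinedOn (ballInf 0 ⌈A / δ⌉₊) →
          νmix S₁ E = νmix ∅ E) →
        ∃ γ : Measure (Ω × Ω), γ.map Prod.fst = μIK ∧ γ.map Prod.snd = μIK ∧
          γ (badPair K δ ε ρ) ≤ π (badObs K δ ε ρ))
    (K₁ : ℂ ≃L[ℝ] ℂ)
    (hK₁ : ∀ ε ρ A : ℝ, 0 < ε → 0 < ρ → 0 < A →
      ∀ᶠ δ in 𝓝[>] (0 : ℝ), ∃ (S₀ S₁ : Set ℤ) (π : Measure (Obs × Obs)),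
        (∀ j : ℤ, |j| ≤ (⌈A / δ⌉₊ : ℤ) → j ∈ S₀ ∧ j ∉ S₁) ∧
        π.map Prod.fst = νmix S₀ ∧ π.map Prod.snd = νmix S₁ ∧
        π (badObs K₁ δ ε ρ) ≤ ENNReal.ofReal ε) :
    IsTransportCoupling K₁ := by
  intro ε ρ hε hρ
  obtain ⟨A, hA, hlift⟩ := hS₃ K₁ ε ρ
  filter_upwards [hK₁ ε ρ A hε hρ hA, Ioo_mem_nhdsGT (zero_lt_one' ℝ)] with δ hδ hδ01
  obtain ⟨S₀, S₁, π, hblk, h1, h2, hbad⟩ := hδ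
  set R : ℕ := ⌈A / δ⌉₊ with hR
  -- the window laws of the two block patterns, from the strip law
  have hsub : ballInf (0 : Site 2) R ⊆ colStrip (-(R : ℤ)) R := ballInf_zero_subset_colStrip R
  have hw₀ : ∀ E : Set Obs, MeasurableSet E → E ∈ determinedOn (ballInf 0 R) →
      νmix S₀ E = νmix Set.univ E := fun E hE hdet =>
    hS₁ S₀ Set.univ (-(R : ℤ)) R (fun j hj hj' =>
      ⟨fun _ => Set.mem_univ j, fun _ => (hblk j (abs_le.2 ⟨hj, hj'⟩)).1⟩) E hE
      (ltr_determinedOn_mono hsub hdet)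
  have hw₁ : ∀ E : Set Obs, MeasurableSet E → E ∈ determinedOn (ballInf 0 R) →
      νmix S₁ E = νmix ∅ E := fun E hE hdet =>
    hS₁ S₁ ∅ (-(R : ℤ)) R (fun j hj hj' =>
      ⟨fun hj₁ => ((hblk j (abs_le.2 ⟨hj, hj'⟩)).2 hj₁).elim, fun h => (Set.notMem_empty j h).elim⟩)
      E hE (ltr_determinedOn_mono hsub hdet)
  obtain ⟨γ, hγ1, hγ2, hγbad⟩ := hlift δ hδ01.1 hδ01.2.le S₀ S₁ π h1 h2 hw₀ hw₁
  exact ⟨γ, hγ1, hγ2, hγbad.trans hbad⟩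

/-- **THE COMPOSITION (registered signature VERBATIM)** · `linearTransport_of_parts`:
`stripLaw` → `windowTransport` → `couplingLift` → the registered signature of `stub_LinearTransport`.
Sorry-free; the three hypotheses are the three piece statements. [folklore] -/
theorem linearTransport_of_parts :
    (∀ (S S' : Set ℤ) (a b : ℤ), (∀ j : ℤ, a ≤ j → j ≤ b → (j ∈ S ↔ j ∈ S')) →
      ∀ E : Set Obs, MeasurableSet E → E ∈ determinedOn (colStrip a b) → νmix S E = νmix S' E) →
    ((∃ C c : ℝ, 0 < c ∧ ∀ (S : Set ℤ) (i : ℤ), (i ∈ S ↔ i + 1 ∉ S) →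
          ∃ T : Obs → Rnd → Obs, IsExchangeKernel C c S i T) →
      (∃ c : ℝ, 0 < c ∧ ∀ (S : Set ℤ) (n : ℕ), 1 ≤ n → ∀ (a b : ℤ) (E : Set Obs), MeasurableSet E →
          CondRSWBound c S n a b E) →
      ∃ K₁ : ℂ ≃L[ℝ] ℂ, ∀ ε ρ A : ℝ, 0 < ε → 0 < ρ → 0 < A →
        ∀ᶠ δ in 𝓝[>] (0 : ℝ), ∃ (S₀ S₁ : Set ℤ) (π : Measure (Obs × Obs)),
          (∀ j : ℤ, |j| ≤ (⌈A / δ⌉₊ : ℤ) → j ∈ S₀ ∧ j ∉ S₁) ∧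
          π.map Prod.fst = νmix S₀ ∧ π.map Prod.snd = νmix S₁ ∧
          π (badObs K₁ δ ε ρ) ≤ ENNReal.ofReal ε) →
    (∀ (K : ℂ ≃L[ℝ] ℂ) (ε ρ : ℝ), ∃ A : ℝ, 0 < A ∧ ∀ δ : ℝ, 0 < δ → δ ≤ 1 →
      ∀ (S₀ S₁ : Set ℤ) (π : Measure (Obs × Obs)),
        π.map Prod.fst = νmix S₀ → π.map Prod.snd = νmix S₁ →
        (∀ E : Set Obs, MeasurableSet E → E ∈ determinedOn (ballInf 0 ⌈A / δ⌉₊) →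
          νmix S₀ E = νmix Set.univ E) →
        (∀ E : Set Obs, MeasurableSet E → E ∈ determinedOn (ballInf 0 ⌈A / δ⌉₊) →
          νmix S₁ E = νmix ∅ E) →
        ∃ γ : Measure (Ω × Ω), γ.map Prod.fst = μIK ∧ γ.map Prod.snd = μIK ∧
          γ (badPair K δ ε ρ) ≤ π (badObs K δ ε ρ)) →
    ((∃ C c : ℝ, 0 < c ∧ ∀ (S : Set ℤ) (i : ℤ), (i ∈ S ↔ i + 1 ∉ S) →
        ∃ T : Obs → Rnd → Obs, IsExchangeKernel C c S i T) →
      (∃ c : ℝ, 0 < c ∧ ∀ (S : Set ℤ) (n : ℕ), 1 ≤ n → ∀ (a b : ℤ) (E : Set Obs), MeasurableSet E →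
        CondRSWBound c S n a b E) →
      ∃ K₁ : ℂ ≃L[ℝ] ℂ, IsTransportCoupling K₁) := by
  intro hS₁ hS₂ hS₃ hK hRSW
  obtain ⟨K₁, hK₁⟩ := hS₂ hK hRSW
  exact ⟨K₁, isTransportCoupling_of_window hS₁ hS₃ K₁ hK₁⟩

/-- **THE COMPOSITION (corrected signature)** · `linearTransport_of_parts_far`:
`stripLaw` → `windowTransportFar` → `couplingLift` → (kernels → far RSW family → ratio mixing family →
`∃ K₁, IsTransportCoupling K₁`).  Sorry-free. [folklore] -/
theorem linearTransport_of_parts_far :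
    (∀ (S S' : Set ℤ) (a b : ℤ), (∀ j : ℤ, a ≤ j → j ≤ b → (j ∈ S ↔ j ∈ S')) →
      ∀ E : Set Obs, MeasurableSet E → E ∈ determinedOn (colStrip a b) → νmix S E = νmix S' E) →
    ((∃ C c : ℝ, 0 < c ∧ ∀ (S : Set ℤ) (i : ℤ), (i ∈ S ↔ i + 1 ∉ S) →
          ∃ T : Obs → Rnd → Obs, IsExchangeKernel C c S i T) →
      (∀ k : ℕ, ∃ c : ℝ, 0 < c ∧ ∀ (S : Set ℤ) (n : ℕ), 1 ≤ n → ∀ (a b : ℤ) (w h : ℕ),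
          n ≤ w → w ≤ k * n → n ≤ h → h ≤ k * n → ∀ E : Set Obs, MeasurableSet E →
          FarRSWBound c S n a b w h E) →
      (∀ (k : ℕ) (η : ℝ), 0 < η → ∃ N : ℕ, ∀ (S : Set ℤ) (n : ℕ), N ≤ n → ∀ (a b : ℤ) (w h : ℕ),
          w ≤ k * n → h ≤ k * n → ∀ E L : Set Obs, MeasurableSet E → MeasurableSet L →
          RatioMixBound η S n a b w h E L) →
      ∃ K₁ : ℂ ≃L[ℝ] ℂ, ∀ ε ρ A : ℝ, 0 < ε → 0 < ρ → 0 < A →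
        ∀ᶠ δ in 𝓝[>] (0 : ℝ), ∃ (S₀ S₁ : Set ℤ) (π : Measure (Obs × Obs)),
          (∀ j : ℤ, |j| ≤ (⌈A / δ⌉₊ : ℤ) → j ∈ S₀ ∧ j ∉ S₁) ∧
          π.map Prod.fst = νmix S₀ ∧ π.map Prod.snd = νmix S₁ ∧
          π (badObs K₁ δ ε ρ) ≤ ENNReal.ofReal ε) →
    (∀ (K : ℂ ≃L[ℝ] ℂ) (ε ρ : ℝ), ∃ A : ℝ, 0 < A ∧ ∀ δ : ℝ, 0 < δ → δ ≤ 1 →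
      ∀ (S₀ S₁ : Set ℤ) (π : Measure (Obs × Obs)),
        π.map Prod.fst = νmix S₀ → π.map Prod.snd = νmix S₁ →
        (∀ E : Set Obs, MeasurableSet E → E ∈ determinedOn (ballInf 0 ⌈A / δ⌉₊) →
          νmix S₀ E = νmix Set.univ E) →
        (∀ E : Set Obs, MeasurableSet E → E ∈ determinedOn (ballInf 0 ⌈A / δ⌉₊) →
          νmix S₁ E = νmix ∅ E) →
        ∃ γ : Measure (Ω × Ω), γ.map Prod.fst = μIK ∧ γ.map Prod.snd = μIK ∧
          γ (badPair K δ ε ρ) ≤ π (badObs K δ ε ρ)) →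
    ((∃ C c : ℝ, 0 < c ∧ ∀ (S : Set ℤ) (i : ℤ), (i ∈ S ↔ i + 1 ∉ S) →
        ∃ T : Obs → Rnd → Obs, IsExchangeKernel C c S i T) →
      (∀ k : ℕ, ∃ c : ℝ, 0 < c ∧ ∀ (S : Set ℤ) (n : ℕ), 1 ≤ n → ∀ (a b : ℤ) (w h : ℕ),
        n ≤ w → w ≤ k * n → n ≤ h → h ≤ k * n → ∀ E : Set Obs, MeasurableSet E →
        FarRSWBound c S n a b w h E) →
      (∀ (k : ℕ) (η : ℝ), 0 < η → ∃ N : ℕ, ∀ (S : Set ℤ) (n : ℕ), N ≤ n → ∀ (a b : ℤ) (w h : ℕ),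
        w ≤ k * n → h ≤ k * n → ∀ E L : Set Obs, MeasurableSet E → MeasurableSet L →
        RatioMixBound η S n a b w h E L) →
      ∃ K₁ : ℂ ≃L[ℝ] ℂ, IsTransportCoupling K₁) := by
  intro hS₁ hS₂ hS₃ hK hRSW hMix
  obtain ⟨K₁, hK₁⟩ := hS₂ hK hRSW hMix
  exact ⟨K₁, isTransportCoupling_of_window hS₁ hS₃ K₁ hK₁⟩

end Summit.CriticalPhenomena.CardyFormulaZ2.Theorems.IKLinearTransport.PinnedDiagramExchange

end
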